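import Mathlib.Analysis.InnerProductSpace.Trace
import Mathlib.Analysis.SpecialFunctions.Sqrt
import Literature.Analysis.FunctionSpaces.TorusClassicalNSUniqueness
import Literature.Analysis.FluidPDE.PassiveScalarVelocityStability
import Literature.Analysis.FluidPDE.TorusClassicalNSTimeDerivLinearised
import HarnessLib

/-!
# Energy stability of classical Navier–Stokes solutions under a force defect (flat torus)

Function-space support file (all results proved; no definitions, no named facts) for the accepted
notion `Torus.IsClassicalNSSolutionOn S ν f u p` (`TorusFluidGlue`), continuing
`TorusClassicalNSUniqueness` (same force) to TWO forces. For classical solutions `(u₁, p₁)` with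
force `f₁` and `(u₂, p₂)` with force `f₂` of the Navier–Stokes system on `[0, T] × T^d` with the same
viscosity `ν ≥ 0`, the difference `w = u₁ - u₂` solves
`∂ₜw + (u₁·∇)w + (w·∇)u₂ = -∇(p₁ - p₂) + νΔw + (f₁ - f₂)` (Majda–Bertozzi 2002, §3.1.1, the display
after (3.2)), whence the *basic energy identity*
`½ d/dt ‖w‖₀² + ν‖∇w‖₀² = -((w·∇)u₂, w) + (f₁ - f₂, w)` and, by the Schwarz inequality (3.4) and
Grönwall's lemma in Duhamel form (Majda–Bertozzi Lemma 3.1; Doering–Gibbon 1995, Lemma 2.1, proved by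
the integrating factor `exp[-G]`, (2.2.14)–(2.2.16)), the basic energy estimate (Prop. 3.1, (3.7)).
We prove it with the growth rate read off from the one-sided bound on the quadratic form of the
velocity gradient of the reference solution, `-⟪ξ, (ξ·∇)u₂(t, x)⟫ ≤ Λ(t)‖ξ‖²` (the quadratic form
`∫ δu·(∇U)·δu` of Doering–Gibbon's energy evolution equation (2.2.10)), which `|∇u₂|_{L∞}` bounds:

* `Torus.IsClassicalNSSolutionOn.timeDerivWithin_sub_eq_of_forces`,
  `Torus.IsClassicalNSSolutionOn.hasDerivWithinAt_integral_norm_sq_sub_of_forces` — the difference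
  equation and the energy identity `E' = 2ν∫⟪Δw, w⟫ - 2∫⟪(w·∇)u₂, w⟫ + 2∫⟪f₁ - f₂, w⟫` within `[a, b]`;
* `Torus.IsClassicalNSSolutionOn.sqrt_integral_norm_sub_sq_le_of_forces` — **the basic energy
  estimate in Duhamel form**: if `u₁(0) = u₂(0)` then, for `t ∈ [0, T] ⊆ S`,
  `‖(u₁ - u₂)(t)‖₀ ≤ ∫₀ᵗ exp(∫ₛᵗ Λ) ‖(f₁ - f₂)(s)‖₀ ds`;
* `Torus.neg_inner_convect_le_of_inner_convect_le` — in the plane, for a divergence-free field the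
  quadratic form of the velocity gradient is trace free, so an upper bound `⟪ξ, (ξ·∇)u⟫ ≤ Λ‖ξ‖²` is
  also the lower bound `-⟪ξ, (ξ·∇)u⟫ ≤ Λ‖ξ‖²` (`⟪ξ, Aξ⟫ + ⟪ξ^⊥, Aξ^⊥⟫ = ‖ξ‖² tr A = ‖ξ‖² div u = 0`);
* `Torus.IsClassicalNSSolutionOn.sqrt_vectorL2Sq_sub_le_duhamel_fin_two` — the planar statement with
  the upper-bound strain hypothesis and the rate `max(Λ, 0)` (the form used by the cell ad-ideate-p2,
  predicate `NSEnergyStability` of the DriftFree line of crux K3loc).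

What is NOT here: weak (Leray) solutions, and the version with `∫‖∇w‖²` kept on the left.

## Mathlib / tree search

Tree (reused): `….timeDerivWithin_sub_eq`, `….energy_deriv_sub_le` (same force; the pattern),
`Torus.integral_inner_convect_self_right_eq_zero`, `Torus.integral_inner_laplacian_self_nonpos`,
`Torus.integral_inner_gradient_eq_zero_of_isDivFree` (`TorusClassicalNSUniqueness`),
`Torus.IsClassicalNSSolutionOn.smooth_force` (`TorusClassicalNSTimeDerivLinearised`: the force of a
classical solution is jointly smooth),
`Torus.IsSmoothSpaceTimeOn.timeDerivWithin/convect/laplacian/gradient/hasDerivWithinAt_integral/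
continuousOn_integral` (`TorusSpaceTime`), `Torus.integral_mul_le_sqrt_mul_sqrt`
(`TorusDiffMonomialBounds`), the comparison lemma
`FluidPDE.Torus.sqrt_le_sqrt_add_integral_of_hasDerivWithinAt` (`PassiveScalarVelocityStability`,
the case `Λ = 0`, to which the integrating factor reduces the general case),
`Torus.divergence_eq_trace_fderiv` (`TorusCalculus`); searched `of_forces`, `force_sub`,
`duhamel` with `IsClassicalNSSolutionOn`: none. Mathlib: `LinearMap.trace_eq_sum_inner`,
`EuclideanSpace.basisFun`, `HasDerivWithinAt.exp/.mul`, `intervalIntegral.integral_interval_sub_left`.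

## References

* A. J. Majda, A. L. Bertozzi, *Vorticity and Incompressible Flow*, CUP 2002, §3.1.1: the difference
  equation after (3.2), the basic energy identity, (3.4)–(3.6), Lemma 3.1 (Grönwall, Duhamel form)
  and Prop. 3.1 (3.7) (basic energy estimate for two forces). [MajdaBertozziCUP2002]
* C. R. Doering, J. D. Gibbon, *Applied Analysis of the Navier–Stokes Equations*, CUP 1995, §2.2,
  (2.2.10) (energy evolution of a perturbation with the quadratic form of `∇U`) and Lemma 2.1,
  (2.2.11)–(2.2.16) (Grönwall's lemma by the integrating factor `exp[-G]`). [DoeringGibbon1995]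
-/

open MeasureTheory Set Filter
open scoped InnerProductSpace ContDiff Topology

noncomputable section

namespace Literature.Analysis.FunctionSpaces

namespace Torus

variable {d : Type*} [Fintype d] [DecidableEq d]

/-! ## The difference equation and the energy identity for two forces -/

section Difference

variable {a b ν : ℝ} {f₁ f₂ u₁ u₂ : ℝ → UnitAddTorus d → EuclideanSpace ℝ d}
  {p₁ p₂ : ℝ → UnitAddTorus d → ℝ}

/-- **The equation for the difference, two forces.** For classical solutions `(u₁, p₁)` (force `f₁`)
and `(u₂, p₂)` (force `f₂`) of the Navier–Stokes system on `[a, b] × T^d` with the same viscosity,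
`w = u₁ - u₂` satisfies `∂ₜw = ν(Δu₁ - Δu₂) - ((u₁·∇)w + (w·∇)u₂) - ∇(p₁ - p₂) + (f₁ - f₂)` pointwise
(`(u₁·∇)u₁ - (u₂·∇)u₂ = (u₁·∇)w + (w·∇)u₂`).
[cite: MajdaBertozziCUP2002, §3.1.1, the display after (3.2)] -/
theorem IsClassicalNSSolutionOn.timeDerivWithin_sub_eq_of_forces
    (h₁ : IsClassicalNSSolutionOn (Icc a b) ν f₁ u₁ p₁)
    (h₂ : IsClassicalNSSolutionOn (Icc a b) ν f₂ u₂ p₂) (hab : a < b) {t : ℝ} (ht : t ∈ Icc a b)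
    (x : UnitAddTorus d) :
    timeDerivWithin (Icc a b) (fun s y => u₁ s y - u₂ s y) t x =
      ν • (laplacian (u₁ t) x - laplacian (u₂ t) x) -
        (convect (u₁ t) (fun y => u₁ t y - u₂ t y) x +
          convect (fun y => u₁ t y - u₂ t y) (u₂ t) x) -
        gradient (fun y => p₁ t y - p₂ t y) x + (f₁ t x - f₂ t x) := by
  have hm₁ := h₁.momentum t ht x
  have hm₂ := h₂.momentum t ht x
  have hs₁ : IsContDiff 1 (u₁ t) := (h₁.smooth_velocity.isSmooth_slice ht).isContDiff (by simp)
  have hs₂ : IsContDiff 1 (u₂ t) := (h₂.smooth_velocity.isSmooth_slice ht).isContDiff (by simp)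
  have hq₁ : IsContDiff 1 (p₁ t) := (h₁.smooth_pressure.isSmooth_slice ht).isContDiff (by simp)
  have hq₂ : IsContDiff 1 (p₂ t) := (h₂.smooth_pressure.isSmooth_slice ht).isContDiff (by simp)
  -- the convective terms: `(u₁·∇)u₁ - (u₂·∇)u₂ = (u₁·∇)w + (w·∇)u₂`
  have hconv : convect (u₁ t) (u₁ t) x - convect (u₂ t) (u₂ t) x =
      convect (u₁ t) (fun y => u₁ t y - u₂ t y) x +
        convect (fun y => u₁ t y - u₂ t y) (u₂ t) x := by
    have hw : (fun y => u₁ t y - u₂ t y) = u₁ t - u₂ t := rfl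
    simp only [convect, hw, fderiv_sub hs₁ hs₂, sub_apply, map_sub]
    abel
  have hgrad : gradient (fun y => p₁ t y - p₂ t y) x = gradient (p₁ t) x - gradient (p₂ t) x := by
    have hq : (fun y => p₁ t y - p₂ t y) = p₁ t - p₂ t := rfl
    rw [hq, gradient_sub hq₁ hq₂]
  have hsub : timeDerivWithin (Icc a b) (fun s y => u₁ s y - u₂ s y) t x =
      timeDerivWithin (Icc a b) u₁ t x - timeDerivWithin (Icc a b) u₂ t x :=
    ((h₁.smooth_velocity.hasDerivWithinAt_slice ht x).sub
      (h₂.smooth_velocity.hasDerivWithinAt_slice ht x)).derivWithin (uniqueDiffOn_Icc hab t ht)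
  rw [hsub, hgrad, ← hconv, smul_sub]
  -- now pure algebra from the two momentum equations
  have e₁ := eq_sub_of_add_eq hm₁
  have e₂ := eq_sub_of_add_eq hm₂
  rw [e₁, e₂]
  abel

/-- **Energy identity for the difference, two forces.** For classical solutions `(u₁, p₁)` (force
`f₁`) and `(u₂, p₂)` (force `f₂`) on `[a, b] × T^d` (`a < b`, same viscosity), `w = u₁ - u₂`
satisfies, within `[a, b]`, `d/dt ∫ ‖w‖² = 2ν∫⟪Δw, w⟫ - 2∫ ⟪(w·∇)u₂, w⟫ + 2∫ ⟪f₁ - f₂, w⟫`: pair the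
difference equation with `w`; the transport term `∫⟪(u₁·∇)w, w⟫` and the pressure term vanish since
`div u₁ = div w = 0` (the *basic energy identity*
`½ d/dt‖w‖₀² + ν‖∇w‖₀² = -((w·∇)u₂, w) + (f₁ - f₂, w)`).
[cite: MajdaBertozziCUP2002, §3.1.1 basic energy identity (the display before (3.3))] -/
theorem IsClassicalNSSolutionOn.hasDerivWithinAt_integral_norm_sq_sub_of_forces
    (h₁ : IsClassicalNSSolutionOn (Icc a b) ν f₁ u₁ p₁)
    (h₂ : IsClassicalNSSolutionOn (Icc a b) ν f₂ u₂ p₂) (hab : a < b) {t : ℝ} (ht : t ∈ Icc a b) :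
    HasDerivWithinAt (fun s => ∫ x, ‖u₁ s x - u₂ s x‖ ^ 2)
      (2 * ν * (∫ x, ⟪laplacian (fun y => u₁ t y - u₂ t y) x, u₁ t x - u₂ t x⟫_ℝ) -
        2 * (∫ x, ⟪convect (fun y => u₁ t y - u₂ t y) (u₂ t) x, u₁ t x - u₂ t x⟫_ℝ) +
        2 * ∫ x, ⟪f₁ t x - f₂ t x, u₁ t x - u₂ t x⟫_ℝ)
      (Icc a b) t := by
  have hU : UniqueDiffOn ℝ (Icc a b) := uniqueDiffOn_Icc hab
  set w : ℝ → UnitAddTorus d → EuclideanSpace ℝ d := fun s y => u₁ s y - u₂ s y with hw_def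
  set F : ℝ → UnitAddTorus d → EuclideanSpace ℝ d := fun s y => f₁ s y - f₂ s y with hF_def
  have hw : IsSmoothSpaceTimeOn (Icc a b) w := h₁.smooth_velocity.sub h₂.smooth_velocity
  have hF : IsSmoothSpaceTimeOn (Icc a b) F :=
    (h₁.smooth_force hU).sub (h₂.smooth_force hU)
  have hwt : IsSmooth (w t) := hw.isSmooth_slice ht
  have hFt : IsSmooth (F t) := hF.isSmooth_slice ht
  have hu₁t : IsSmooth (u₁ t) := h₁.smooth_velocity.isSmooth_slice ht
  have hu₂t : IsSmooth (u₂ t) := h₂.smooth_velocity.isSmooth_slice ht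
  have hqt : IsSmooth (fun y => p₁ t y - p₂ t y) :=
    (h₁.smooth_pressure.isSmooth_slice ht).sub (h₂.smooth_pressure.isSmooth_slice ht)
  have hdivw : IsDivFree (w t) := by
    intro x
    have hw' : w t = u₁ t - u₂ t := rfl
    rw [hw', divergence_sub (hu₁t.isContDiff (by simp)) (hu₂t.isContDiff (by simp)),
      h₁.divFree t ht x, h₂.divFree t ht x, sub_zero]
  have hlapw : ∀ x, laplacian (u₁ t) x - laplacian (u₂ t) x = laplacian (w t) x := by
    intro x
    have hw' : w t = u₁ t - u₂ t := rfl
    rw [hw', laplacian_sub hu₁t hu₂t, Pi.sub_apply]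
  have hderiv : ∀ x, timeDerivWithin (Icc a b) w t x =
      ν • laplacian (w t) x - (convect (u₁ t) (w t) x + convect (w t) (u₂ t) x) -
        gradient (fun y => p₁ t y - p₂ t y) x + F t x := by
    intro x
    rw [← hlapw x]
    exact h₁.timeDerivWithin_sub_eq_of_forces h₂ hab ht x
  -- differentiate under the integral sign; `∂ₜ‖w‖² = 2⟪∂ₜw, w⟫`
  have hφ : IsSmoothSpaceTimeOn (Icc a b) (fun s x => ‖w s x‖ ^ 2) := hw.norm_sq ℝ
  have hE := hφ.hasDerivWithinAt_integral (convex_Icc a b) ht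
  have hpt : ∀ x, timeDerivWithin (Icc a b) (fun s x => ‖w s x‖ ^ 2) t x =
      2 * ⟪timeDerivWithin (Icc a b) w t x, w t x⟫_ℝ := by
    intro x
    have h1 := ((hw.hasDerivWithinAt_slice ht x).norm_sq).derivWithin (hU t ht)
    change derivWithin (fun τ => ‖w τ x‖ ^ 2) (Icc a b) t = _
    rw [h1, real_inner_comm]
  have hi0 : Integrable (fun x => ⟪laplacian (w t) x, w t x⟫_ℝ) volume :=
    (hwt.laplacian.inner hwt).integrable
  have hi1 : Integrable (fun x => ⟪convect (u₁ t) (w t) x, w t x⟫_ℝ) volume :=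
    ((hu₁t.convect hwt).inner hwt).integrable
  have hi2 : Integrable (fun x => ⟪convect (w t) (u₂ t) x, w t x⟫_ℝ) volume :=
    ((hwt.convect hu₂t).inner hwt).integrable
  have hi3 : Integrable (fun x => ⟪gradient (fun y => p₁ t y - p₂ t y) x, w t x⟫_ℝ) volume :=
    (hqt.gradient.inner hwt).integrable
  have hi4 : Integrable (fun x => ⟪F t x, w t x⟫_ℝ) volume := (hFt.inner hwt).integrable
  have hE't : ∫ x, timeDerivWithin (Icc a b) (fun s x => ‖w s x‖ ^ 2) t x =
      2 * ν * (∫ x, ⟪laplacian (w t) x, w t x⟫_ℝ) - 2 * (∫ x, ⟪convect (w t) (u₂ t) x, w t x⟫_ℝ) +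
        2 * ∫ x, ⟪F t x, w t x⟫_ℝ := by
    have hcongr : (fun x => timeDerivWithin (Icc a b) (fun s x => ‖w s x‖ ^ 2) t x) = fun x =>
        2 * (ν * ⟪laplacian (w t) x, w t x⟫_ℝ) - 2 * ⟪convect (u₁ t) (w t) x, w t x⟫_ℝ -
          2 * ⟪convect (w t) (u₂ t) x, w t x⟫_ℝ -
          2 * ⟪gradient (fun y => p₁ t y - p₂ t y) x, w t x⟫_ℝ + 2 * ⟪F t x, w t x⟫_ℝ := by
      funext x
      rw [hpt, hderiv]
      simp only [inner_add_left, inner_sub_left, real_inner_smul_left]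
      ring
    have j0 : Integrable (fun x => 2 * (ν * ⟪laplacian (w t) x, w t x⟫_ℝ)) volume :=
      (hi0.const_mul ν).const_mul 2
    have j1 : Integrable (fun x => 2 * ⟪convect (u₁ t) (w t) x, w t x⟫_ℝ) volume := hi1.const_mul 2
    have j2 : Integrable (fun x => 2 * ⟪convect (w t) (u₂ t) x, w t x⟫_ℝ) volume := hi2.const_mul 2
    have j3 : Integrable (fun x => 2 * ⟪gradient (fun y => p₁ t y - p₂ t y) x, w t x⟫_ℝ) volume :=
      hi3.const_mul 2
    have j4 : Integrable (fun x => 2 * ⟪F t x, w t x⟫_ℝ) volume := hi4.const_mul 2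
    have j01 : Integrable (fun x => 2 * (ν * ⟪laplacian (w t) x, w t x⟫_ℝ) -
        2 * ⟪convect (u₁ t) (w t) x, w t x⟫_ℝ) volume := j0.sub j1
    have j012 : Integrable (fun x => 2 * (ν * ⟪laplacian (w t) x, w t x⟫_ℝ) -
        2 * ⟪convect (u₁ t) (w t) x, w t x⟫_ℝ - 2 * ⟪convect (w t) (u₂ t) x, w t x⟫_ℝ) volume :=
      j01.sub j2
    have j0123 : Integrable (fun x => 2 * (ν * ⟪laplacian (w t) x, w t x⟫_ℝ) -
        2 * ⟪convect (u₁ t) (w t) x, w t x⟫_ℝ - 2 * ⟪convect (w t) (u₂ t) x, w t x⟫_ℝ -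
        2 * ⟪gradient (fun y => p₁ t y - p₂ t y) x, w t x⟫_ℝ) volume := j012.sub j3
    have s1 : ∫ x, (2 * (ν * ⟪laplacian (w t) x, w t x⟫_ℝ) -
        2 * ⟪convect (u₁ t) (w t) x, w t x⟫_ℝ - 2 * ⟪convect (w t) (u₂ t) x, w t x⟫_ℝ -
        2 * ⟪gradient (fun y => p₁ t y - p₂ t y) x, w t x⟫_ℝ + 2 * ⟪F t x, w t x⟫_ℝ) =
        (∫ x, (2 * (ν * ⟪laplacian (w t) x, w t x⟫_ℝ) -
          2 * ⟪convect (u₁ t) (w t) x, w t x⟫_ℝ - 2 * ⟪convect (w t) (u₂ t) x, w t x⟫_ℝ -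
          2 * ⟪gradient (fun y => p₁ t y - p₂ t y) x, w t x⟫_ℝ)) + ∫ x, 2 * ⟪F t x, w t x⟫_ℝ :=
      integral_add j0123 j4
    have s2 : ∫ x, (2 * (ν * ⟪laplacian (w t) x, w t x⟫_ℝ) -
        2 * ⟪convect (u₁ t) (w t) x, w t x⟫_ℝ - 2 * ⟪convect (w t) (u₂ t) x, w t x⟫_ℝ -
        2 * ⟪gradient (fun y => p₁ t y - p₂ t y) x, w t x⟫_ℝ) =
        (∫ x, (2 * (ν * ⟪laplacian (w t) x, w t x⟫_ℝ) -
          2 * ⟪convect (u₁ t) (w t) x, w t x⟫_ℝ - 2 * ⟪convect (w t) (u₂ t) x, w t x⟫_ℝ)) -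
          ∫ x, 2 * ⟪gradient (fun y => p₁ t y - p₂ t y) x, w t x⟫_ℝ :=
      integral_sub j012 j3
    have s3 : ∫ x, (2 * (ν * ⟪laplacian (w t) x, w t x⟫_ℝ) -
        2 * ⟪convect (u₁ t) (w t) x, w t x⟫_ℝ - 2 * ⟪convect (w t) (u₂ t) x, w t x⟫_ℝ) =
        (∫ x, (2 * (ν * ⟪laplacian (w t) x, w t x⟫_ℝ) -
          2 * ⟪convect (u₁ t) (w t) x, w t x⟫_ℝ)) - ∫ x, 2 * ⟪convect (w t) (u₂ t) x, w t x⟫_ℝ :=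
      integral_sub j01 j2
    have s4 : ∫ x, (2 * (ν * ⟪laplacian (w t) x, w t x⟫_ℝ) -
        2 * ⟪convect (u₁ t) (w t) x, w t x⟫_ℝ) =
        (∫ x, 2 * (ν * ⟪laplacian (w t) x, w t x⟫_ℝ)) -
          ∫ x, 2 * ⟪convect (u₁ t) (w t) x, w t x⟫_ℝ :=
      integral_sub j0 j1
    have s5 : ∫ x, 2 * (ν * ⟪laplacian (w t) x, w t x⟫_ℝ) =
        2 * (ν * ∫ x, ⟪laplacian (w t) x, w t x⟫_ℝ) := by
      rw [integral_const_mul, integral_const_mul]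
    have s6 : ∫ x, 2 * ⟪convect (u₁ t) (w t) x, w t x⟫_ℝ = 0 := by
      rw [integral_const_mul, integral_inner_convect_self_right_eq_zero hu₁t (h₁.divFree t ht) hwt,
        mul_zero]
    have s7 : ∫ x, 2 * ⟪gradient (fun y => p₁ t y - p₂ t y) x, w t x⟫_ℝ = 0 := by
      rw [integral_const_mul, integral_inner_gradient_eq_zero_of_isDivFree hwt hqt hdivw, mul_zero]
    have s8 : ∫ x, 2 * ⟪convect (w t) (u₂ t) x, w t x⟫_ℝ =
        2 * ∫ x, ⟪convect (w t) (u₂ t) x, w t x⟫_ℝ := integral_const_mul _ _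
    have s9 : ∫ x, 2 * ⟪F t x, w t x⟫_ℝ = 2 * ∫ x, ⟪F t x, w t x⟫_ℝ := integral_const_mul _ _
    rw [hcongr, s1, s2, s3, s4, s5, s6, s7, s8, s9]
    ring
  rw [hE't] at hE
  exact hE

end Difference

/-! ## Grönwall in Duhamel form: the basic energy estimate with a force defect -/

section Duhamel

omit [Fintype d] [DecidableEq d] in
/-- A primitive `Φ(t) = ∫ₐᵗ F` of a function continuous on `[a, b]`, differentiable WITHIN `[a, b]`
with derivative `F` (clamp `F` to `[a, b]`, then the fundamental theorem of calculus). [folklore] -/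
private theorem exists_hasDerivWithinAt_eq_integral {F : ℝ → ℝ} {a b : ℝ} (hab : a ≤ b)
    (hF : ContinuousOn F (Icc a b)) :
    ∃ Φ : ℝ → ℝ, (∀ t ∈ Icc a b, HasDerivWithinAt Φ (F t) (Icc a b) t) ∧
      ∀ t ∈ Icc a b, Φ t = ∫ s in a..t, F s := by
  set Ft : ℝ → ℝ := fun s => F (max a (min b s)) with hFt
  have hmem : ∀ s, max a (min b s) ∈ Icc a b := fun s =>
    ⟨le_max_left _ _, max_le hab (min_le_left _ _)⟩
  have hFtc : Continuous Ft :=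
    hF.comp_continuous (continuous_const.max (continuous_const.min continuous_id)) hmem
  have hFt_eq : ∀ s ∈ Icc a b, Ft s = F s := fun s hs => by
    simp only [hFt, min_eq_right hs.2, max_eq_right hs.1]
  refine ⟨fun t => ∫ s in a..t, Ft s, fun t ht => ?_, fun t ht => ?_⟩
  · have h := (hFtc.integral_hasStrictDerivAt a t).hasDerivAt.hasDerivWithinAt (s := Icc a b)
    rwa [hFt_eq t ht] at h
  · refine intervalIntegral.integral_congr fun s hs => hFt_eq s ?_
    rw [uIcc_of_le ht.1] at hs
    exact ⟨hs.1, hs.2.trans ht.2⟩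

variable {ν T : ℝ} {f₁ f₂ u₁ u₂ : ℝ → UnitAddTorus d → EuclideanSpace ℝ d}
  {p₁ p₂ : ℝ → UnitAddTorus d → ℝ}

/-- **Basic energy estimate with a force defect (Duhamel form), on `[0, T]`.** Let `(u₁, p₁)`
(force `f₁`) and `(u₂, p₂)` (force `f₂`) be classical solutions of the Navier–Stokes system on
`[0, T] × T^d`, `T > 0`, with the same viscosity `ν ≥ 0` and the same initial velocity, and let
`Λ` be continuous on `[0, T]` with `-⟪ξ, (ξ·∇)u₂(t, x)⟫ ≤ Λ(t)‖ξ‖²` for all `t, x, ξ` (e.g.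
`Λ = |∇u₂|_{L∞}`). Then `‖(u₁ - u₂)(T)‖_{L²} ≤ ∫₀ᵀ exp(∫ₛᵀ Λ) ‖(f₁ - f₂)(s)‖_{L²} ds`: the energy
identity and the Schwarz inequality give `E' ≤ 2ΛE + 2‖f₁ - f₂‖₀√E` for `E = ‖u₁ - u₂‖₀²` (dropping
`-2ν‖∇w‖₀² ≤ 0`); with the integrating factor `exp(-2∫₀ᵗ Λ)` this is the case `Λ = 0` of the
comparison lemma `φ' ≤ 2√φ g ⇒ √φ(T) ≤ √φ(0) + ∫₀ᵀ g`.
[cite: MajdaBertozziCUP2002, §3.1.1 (3.4)–(3.6), Lemma 3.1 and Prop. 3.1 (3.7)]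
[cite: DoeringGibbon1995, §2.2 (2.2.10) and Lemma 2.1 (2.2.11)–(2.2.16)] -/
theorem IsClassicalNSSolutionOn.sqrt_integral_norm_sub_sq_le_of_forces_Icc
    (h₁ : IsClassicalNSSolutionOn (Icc 0 T) ν f₁ u₁ p₁)
    (h₂ : IsClassicalNSSolutionOn (Icc 0 T) ν f₂ u₂ p₂) (hν : 0 ≤ ν) (hT : 0 < T)
    (h0 : u₁ 0 = u₂ 0) {Λ : ℝ → ℝ}
    (hΛ : ∀ t ∈ Icc 0 T, ∀ (x : UnitAddTorus d) (ξ : EuclideanSpace ℝ d),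
      -⟪ξ, convect (fun _ => ξ) (u₂ t) x⟫_ℝ ≤ Λ t * ‖ξ‖ ^ 2)
    (hΛc : ContinuousOn Λ (Icc 0 T)) :
    Real.sqrt (∫ x, ‖u₁ T x - u₂ T x‖ ^ 2) ≤
      ∫ s in (0 : ℝ)..T, Real.exp (∫ τ in s..T, Λ τ) * Real.sqrt (∫ x, ‖f₁ s x - f₂ s x‖ ^ 2) := by
  have hT0 : (0 : ℝ) ≤ T := hT.le
  have hU : UniqueDiffOn ℝ (Icc (0 : ℝ) T) := uniqueDiffOn_Icc hT
  have hconv : Convex ℝ (Icc (0 : ℝ) T) := convex_Icc 0 T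
  set w : ℝ → UnitAddTorus d → EuclideanSpace ℝ d := fun s y => u₁ s y - u₂ s y with hw_def
  set F : ℝ → UnitAddTorus d → EuclideanSpace ℝ d := fun s y => f₁ s y - f₂ s y with hF_def
  have hw : IsSmoothSpaceTimeOn (Icc 0 T) w := h₁.smooth_velocity.sub h₂.smooth_velocity
  have hu₂ := h₂.smooth_velocity
  have hF : IsSmoothSpaceTimeOn (Icc 0 T) F :=
    (h₁.smooth_force hU).sub (h₂.smooth_force hU)
  -- a primitive `A = ∫₀ᵗ Λ` within `[0, T]`
  obtain ⟨A, hA, hAint⟩ := exists_hasDerivWithinAt_eq_integral hT0 hΛc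
  have hAc : ContinuousOn A (Icc 0 T) := fun t ht => (hA t ht).continuousWithinAt
  -- the energy, its derivative and the size of the defect
  set E : ℝ → ℝ := fun s => ∫ x, ‖u₁ s x - u₂ s x‖ ^ 2 with hE_def
  set D : ℝ → ℝ := fun t => 2 * ν * (∫ x, ⟪laplacian (w t) x, w t x⟫_ℝ) -
      2 * (∫ x, ⟪convect (w t) (u₂ t) x, w t x⟫_ℝ) + 2 * ∫ x, ⟪F t x, w t x⟫_ℝ with hD_def
  set g : ℝ → ℝ := fun s => Real.sqrt (∫ x, ‖f₁ s x - f₂ s x‖ ^ 2) with hg_def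
  have hEd : ∀ t ∈ Icc (0 : ℝ) T, HasDerivWithinAt E (D t) (Icc 0 T) t := fun t ht =>
    h₁.hasDerivWithinAt_integral_norm_sq_sub_of_forces h₂ hT ht
  have hEc : ContinuousOn E (Icc 0 T) := fun t ht => (hEd t ht).continuousWithinAt
  have hEpos : ∀ t ∈ Icc (0 : ℝ) T, 0 ≤ E t := fun t _ => integral_nonneg fun x => sq_nonneg _
  have hDc : ContinuousOn D (Icc 0 T) := by
    have c1 : ContinuousOn (fun t => 2 * ν * ∫ x, ⟪laplacian (w t) x, w t x⟫_ℝ) (Icc 0 T) :=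
      continuousOn_const.mul (((hw.laplacian hU).inner hw).continuousOn_integral hconv)
    have c2 : ContinuousOn (fun t => 2 * ∫ x, ⟪convect (w t) (u₂ t) x, w t x⟫_ℝ) (Icc 0 T) :=
      continuousOn_const.mul (((hw.convect hu₂ hU).inner hw).continuousOn_integral hconv)
    have c3 : ContinuousOn (fun t => 2 * ∫ x, ⟪F t x, w t x⟫_ℝ) (Icc 0 T) :=
      continuousOn_const.mul ((hF.inner hw).continuousOn_integral hconv)
    have c : ContinuousOn (fun t => 2 * ν * (∫ x, ⟪laplacian (w t) x, w t x⟫_ℝ) -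
        2 * (∫ x, ⟪convect (w t) (u₂ t) x, w t x⟫_ℝ) + 2 * ∫ x, ⟪F t x, w t x⟫_ℝ) (Icc 0 T) :=
      (c1.sub c2).add c3
    exact c
  have hF2 : IsSmoothSpaceTimeOn (Icc 0 T) (fun s x => ‖F s x‖ ^ 2) := hF.norm_sq ℝ
  have hgc : ContinuousOn g (Icc 0 T) := (hF2.continuousOn_integral hconv).sqrt
  have hg0 : ∀ t ∈ Icc (0 : ℝ) T, 0 ≤ g t := fun t _ => Real.sqrt_nonneg _
  -- the differential inequality `E' ≤ 2ΛE + 2 g √E`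
  have hDle : ∀ t ∈ Icc (0 : ℝ) T, D t ≤ 2 * Λ t * E t + 2 * g t * Real.sqrt (E t) := by
    intro t ht
    have hwt : IsSmooth (w t) := hw.isSmooth_slice ht
    have hu₂t : IsSmooth (u₂ t) := hu₂.isSmooth_slice ht
    have hFt : IsSmooth (F t) := hF.isSmooth_slice ht
    -- (i) the viscous term is nonpositive
    have i1 : 2 * ν * (∫ x, ⟪laplacian (w t) x, w t x⟫_ℝ) ≤ 0 :=
      mul_nonpos_of_nonneg_of_nonpos (by positivity) (integral_inner_laplacian_self_nonpos hwt)
    -- (ii) the stretching term, by the one-sided bound on the velocity gradient of `u₂`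
    have i2 : -(2 * ∫ x, ⟪convect (w t) (u₂ t) x, w t x⟫_ℝ) ≤ 2 * Λ t * E t := by
      have hint : Integrable (fun x => ⟪convect (w t) (u₂ t) x, w t x⟫_ℝ) volume :=
        ((hwt.convect hu₂t).inner hwt).integrable
      have hint2 : Integrable (fun x => Λ t * ‖w t x‖ ^ 2) volume :=
        ((hwt.continuous.norm.pow 2).integrable_unitAddTorus).const_mul _
      have hpt : ∀ x, -⟪convect (w t) (u₂ t) x, w t x⟫_ℝ ≤ Λ t * ‖w t x‖ ^ 2 := by
        intro x
        have h := hΛ t ht x (w t x)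
        rwa [real_inner_comm] at h
      have hmono : ∫ x, -⟪convect (w t) (u₂ t) x, w t x⟫_ℝ ≤ ∫ x, Λ t * ‖w t x‖ ^ 2 :=
        integral_mono hint.neg hint2 hpt
      rw [integral_neg, integral_const_mul] at hmono
      have hE : E t = ∫ x, ‖w t x‖ ^ 2 := rfl
      rw [hE]
      linarith
    -- (iii) the force term, by the Schwarz inequality
    have i3 : 2 * ∫ x, ⟪F t x, w t x⟫_ℝ ≤ 2 * g t * Real.sqrt (E t) := by
      have hcs := integral_mul_le_sqrt_mul_sqrt hFt.continuous.norm hwt.continuous.norm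
      have hle : ∫ x, ⟪F t x, w t x⟫_ℝ ≤ ∫ x, ‖F t x‖ * ‖w t x‖ :=
        integral_mono (hFt.inner hwt).integrable
          ((hFt.continuous.norm.mul hwt.continuous.norm).integrable_unitAddTorus)
          fun x => real_inner_le_norm _ _
      have hg : g t = Real.sqrt (∫ x, ‖F t x‖ ^ 2) := rfl
      have hE : E t = ∫ x, ‖w t x‖ ^ 2 := rfl
      rw [hg, hE]
      linarith
    have hD : D t = 2 * ν * (∫ x, ⟪laplacian (w t) x, w t x⟫_ℝ) -
        2 * (∫ x, ⟪convect (w t) (u₂ t) x, w t x⟫_ℝ) + 2 * ∫ x, ⟪F t x, w t x⟫_ℝ := rfl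
    rw [hD]
    linarith
  -- the integrating factor `exp(-2A)`: `φ = exp(-2A) E` has `φ' ≤ 2 √φ · (exp(-A) g)`
  set φ : ℝ → ℝ := fun t => Real.exp (-(2 * A t)) * E t with hφ_def
  set Dφ : ℝ → ℝ := fun t =>
    Real.exp (-(2 * A t)) * (-(2 * Λ t)) * E t + Real.exp (-(2 * A t)) * D t with hDφ_def
  set gφ : ℝ → ℝ := fun t => Real.exp (-A t) * g t with hgφ_def
  have hφd : ∀ t ∈ Icc (0 : ℝ) T, HasDerivWithinAt φ (Dφ t) (Icc 0 T) t := by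
    intro t ht
    have h2A : HasDerivWithinAt (fun s => -(2 * A s)) (-(2 * Λ t)) (Icc 0 T) t :=
      ((hA t ht).const_mul 2).neg
    have h1 : HasDerivWithinAt (fun s => Real.exp (-(2 * A s)))
        (Real.exp (-(2 * A t)) * (-(2 * Λ t))) (Icc 0 T) t := h2A.exp
    have h3 : HasDerivWithinAt (fun s => Real.exp (-(2 * A s)) * E s)
        (Real.exp (-(2 * A t)) * (-(2 * Λ t)) * E t + Real.exp (-(2 * A t)) * D t) (Icc 0 T) t :=
      h1.mul (hEd t ht)
    exact h3
  have h2Ac : ContinuousOn (fun t => -(2 * A t)) (Icc 0 T) := (continuousOn_const.mul hAc).neg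
  have hexpc : ContinuousOn (fun t => Real.exp (-(2 * A t))) (Icc 0 T) := h2Ac.rexp
  have hDφc : ContinuousOn Dφ (Icc 0 T) := by
    have c1 : ContinuousOn (fun t => -(2 * Λ t)) (Icc 0 T) := (continuousOn_const.mul hΛc).neg
    have c2 : ContinuousOn (fun t => Real.exp (-(2 * A t)) * (-(2 * Λ t)) * E t) (Icc 0 T) :=
      (hexpc.mul c1).mul hEc
    have c3 : ContinuousOn (fun t => Real.exp (-(2 * A t)) * D t) (Icc 0 T) := hexpc.mul hDc
    have c : ContinuousOn (fun t => Real.exp (-(2 * A t)) * (-(2 * Λ t)) * E t +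
        Real.exp (-(2 * A t)) * D t) (Icc 0 T) := c2.add c3
    exact c
  have hφpos : ∀ t ∈ Icc (0 : ℝ) T, 0 ≤ φ t := fun t ht =>
    mul_nonneg (Real.exp_pos _).le (hEpos t ht)
  have hexp2 : ∀ t, Real.exp (-(2 * A t)) = Real.exp (-A t) * Real.exp (-A t) := by
    intro t
    rw [← Real.exp_add]
    ring_nf
  have hsqφ : ∀ t ∈ Icc (0 : ℝ) T, Real.sqrt (φ t) = Real.exp (-A t) * Real.sqrt (E t) := by
    intro t ht
    have h : φ t = Real.exp (-(2 * A t)) * E t := rfl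
    rw [h, hexp2 t, Real.sqrt_mul (mul_nonneg (Real.exp_pos _).le (Real.exp_pos _).le),
      Real.sqrt_mul_self (Real.exp_pos _).le]
  have hle : ∀ t ∈ Icc (0 : ℝ) T, Dφ t ≤ 2 * Real.sqrt (φ t) * gφ t := by
    intro t ht
    have hD := hDle t ht
    have hDφ : Dφ t = Real.exp (-(2 * A t)) * (D t - 2 * Λ t * E t) := by
      simp only [hDφ_def]
      ring
    calc Dφ t = Real.exp (-(2 * A t)) * (D t - 2 * Λ t * E t) := hDφ
      _ ≤ Real.exp (-(2 * A t)) * (2 * g t * Real.sqrt (E t)) :=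
          mul_le_mul_of_nonneg_left (by linarith) (Real.exp_pos _).le
      _ = 2 * Real.sqrt (φ t) * gφ t := by
          rw [hsqφ t ht, hexp2 t]
          simp only [hgφ_def]
          ring
  have hgφ0 : ∀ t ∈ Icc (0 : ℝ) T, 0 ≤ gφ t := fun t ht =>
    mul_nonneg (Real.exp_pos _).le (hg0 t ht)
  have hgφc : ContinuousOn gφ (Icc 0 T) := by
    have c1 : ContinuousOn (fun t => -A t) (Icc 0 T) := hAc.neg
    have c : ContinuousOn (fun t => Real.exp (-A t) * g t) (Icc 0 T) := c1.rexp.mul hgc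
    exact c
  have hgφi : IntervalIntegrable gφ volume 0 T := hgφc.intervalIntegrable_of_Icc hT0
  have hmain := FluidPDE.Torus.sqrt_le_sqrt_add_integral_of_hasDerivWithinAt hT0 hφd hDφc hφpos
    hle hgφ0 hgφi
  -- `φ(0) = 0` since `u₁(0) = u₂(0)`
  have hE0 : E 0 = 0 := by
    have h : E 0 = ∫ x, ‖u₁ 0 x - u₂ 0 x‖ ^ 2 := rfl
    rw [h, h0]
    simp
  have hφ0 : Real.sqrt (φ 0) = 0 := by
    rw [hsqφ 0 (left_mem_Icc.2 hT0), hE0, Real.sqrt_zero, mul_zero]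
  rw [hφ0, zero_add] at hmain
  -- unwind the integrating factor: `√E(T) = exp(A T) √φ(T)` and `A T - A s = ∫ₛᵀ Λ`
  have hTmem : T ∈ Icc (0 : ℝ) T := right_mem_Icc.2 hT0
  have hET : Real.sqrt (E T) = Real.exp (A T) * Real.sqrt (φ T) := by
    rw [hsqφ T hTmem, ← mul_assoc, ← Real.exp_add, add_neg_cancel, Real.exp_zero, one_mul]
  have hEq : E T = ∫ x, ‖u₁ T x - u₂ T x‖ ^ 2 := rfl
  rw [← hEq, hET]
  calc Real.exp (A T) * Real.sqrt (φ T)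
      ≤ Real.exp (A T) * ∫ s in (0 : ℝ)..T, gφ s :=
        mul_le_mul_of_nonneg_left hmain (Real.exp_pos _).le
    _ = ∫ s in (0 : ℝ)..T, Real.exp (A T) * gφ s := (intervalIntegral.integral_const_mul _ _).symm
    _ = ∫ s in (0 : ℝ)..T, Real.exp (∫ τ in s..T, Λ τ) *
          Real.sqrt (∫ x, ‖f₁ s x - f₂ s x‖ ^ 2) := by
        refine intervalIntegral.integral_congr fun s hs => ?_
        rw [uIcc_of_le hT0] at hs
        have hΛi : ∀ r ∈ Icc (0 : ℝ) T, IntervalIntegrable Λ volume 0 r := fun r hr =>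
          (hΛc.mono (Icc_subset_Icc_right hr.2)).intervalIntegrable_of_Icc hr.1
        have hsub : ∫ τ in s..T, Λ τ = A T - A s := by
          rw [hAint T hTmem, hAint s hs]
          exact (intervalIntegral.integral_interval_sub_left (hΛi T hTmem) (hΛi s hs)).symm
        have hg : gφ s = Real.exp (-A s) * g s := rfl
        simp only [hg, hsub]
        rw [← mul_assoc, ← Real.exp_add, ← sub_eq_add_neg]

/-- **Basic energy estimate with a force defect (Duhamel form).** Let `(u₁, p₁)` (force `f₁`) and
`(u₂, p₂)` (force `f₂`) be classical solutions of the Navier–Stokes system with the same viscosity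
`ν ≥ 0` on a time set `S ⊇ [0, T]`, with the same initial velocity `u₁(0) = u₂(0)`, and let `Λ` be
continuous on `[0, T]` with `-⟪ξ, (ξ·∇)u₂(t, x)⟫ ≤ Λ(t)‖ξ‖²` on `[0, T] × T^d` (e.g.
`Λ = |∇u₂|_{L∞}`, Majda–Bertozzi's rate). Then for `t ∈ [0, T]`,
`‖(u₁ - u₂)(t)‖_{L²} ≤ ∫₀ᵗ exp(∫ₛᵗ Λ) ‖(f₁ - f₂)(s)‖_{L²} ds` (Grönwall's Lemma 3.1 applied to (3.6):
the Duhamel form of the basic energy estimate (3.7)).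
[cite: MajdaBertozziCUP2002, §3.1.1 (3.4)–(3.6), Lemma 3.1 and Prop. 3.1 (3.7)]
[cite: DoeringGibbon1995, §2.2 (2.2.10) and Lemma 2.1 (2.2.12)] -/
theorem IsClassicalNSSolutionOn.sqrt_integral_norm_sub_sq_le_of_forces {S : Set ℝ}
    (hST : Icc 0 T ⊆ S) (h₁ : IsClassicalNSSolutionOn S ν f₁ u₁ p₁)
    (h₂ : IsClassicalNSSolutionOn S ν f₂ u₂ p₂) (hν : 0 ≤ ν) (h0 : u₁ 0 = u₂ 0) {Λ : ℝ → ℝ}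
    (hΛ : ∀ t ∈ Icc 0 T, ∀ (x : UnitAddTorus d) (ξ : EuclideanSpace ℝ d),
      -⟪ξ, convect (fun _ => ξ) (u₂ t) x⟫_ℝ ≤ Λ t * ‖ξ‖ ^ 2)
    (hΛc : ContinuousOn Λ (Icc 0 T)) {t : ℝ} (ht : t ∈ Icc 0 T) :
    Real.sqrt (∫ x, ‖u₁ t x - u₂ t x‖ ^ 2) ≤
      ∫ s in (0 : ℝ)..t, Real.exp (∫ τ in s..t, Λ τ) * Real.sqrt (∫ x, ‖f₁ s x - f₂ s x‖ ^ 2) := by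
  rcases eq_or_lt_of_le ht.1 with h | hpos
  · subst h
    simp [h0]
  · have hsub : Icc 0 t ⊆ S := (Icc_subset_Icc_right ht.2).trans hST
    have hU : UniqueDiffOn ℝ (Icc 0 t) := uniqueDiffOn_Icc hpos
    exact (h₁.mono hsub hU).sqrt_integral_norm_sub_sq_le_of_forces_Icc (h₂.mono hsub hU) hν hpos h0
      (fun s hs => hΛ s ⟨hs.1, hs.2.trans ht.2⟩) (hΛc.mono (Icc_subset_Icc_right ht.2))

end Duhamel

/-! ## The plane: the quadratic form of a divergence-free velocity gradient is trace free -/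

section Plane

omit [Fintype d] [DecidableEq d] in
/-- `⟪aX + bY, A(aX + bY)⟫ + ⟪-bX + aY, A(-bX + aY)⟫ = (a² + b²)(⟪X, AX⟫ + ⟪Y, AY⟫)` for a real
linear map (the cross terms cancel). [folklore] -/
private theorem inner_map_add_inner_map_rot {E : Type*} [NormedAddCommGroup E]
    [InnerProductSpace ℝ E] (A : E →ₗ[ℝ] E) (X Y : E) (a b : ℝ) :
    ⟪a • X + b • Y, A (a • X + b • Y)⟫_ℝ + ⟪(-b) • X + a • Y, A ((-b) • X + a • Y)⟫_ℝ =
      (a ^ 2 + b ^ 2) * (⟪X, A X⟫_ℝ + ⟪Y, A Y⟫_ℝ) := by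
  simp only [map_add, map_smul, inner_add_left, inner_add_right, real_inner_smul_left,
    real_inner_smul_right]
  ring

/-- **In the plane an upper bound on the quadratic form of a divergence-free velocity gradient is a
two-sided bound.** For a `C¹` divergence-free field `u` on `T²` and a point `x`, if
`⟪ξ, (ξ·∇)u(x)⟫ ≤ Λ‖ξ‖²` for all `ξ`, then also `-⟪ξ, (ξ·∇)u(x)⟫ ≤ Λ‖ξ‖²`: with `ξ^⊥ = (-ξ₂, ξ₁)`,
`⟪ξ, ∇u ξ⟫ + ⟪ξ^⊥, ∇u ξ^⊥⟫ = ‖ξ‖² tr ∇u = ‖ξ‖² div u = 0` and `‖ξ^⊥‖ = ‖ξ‖` (the rate-of-strain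
matrix `D = ½(∇U + ∇Uᵀ)` of a planar incompressible flow is trace free, so its eigenvalues are `±λ`).
[cite: DoeringGibbon1995, §2.2 (2.2.10), (2.2.23)] -/
theorem neg_inner_convect_le_of_inner_convect_le
    {u : UnitAddTorus (Fin 2) → EuclideanSpace ℝ (Fin 2)} (hu : IsContDiff 1 u) (hdiv : IsDivFree u)
    {x : UnitAddTorus (Fin 2)} {Λ : ℝ}
    (hle : ∀ ξ : EuclideanSpace ℝ (Fin 2), ⟪ξ, convect (fun _ => ξ) u x⟫_ℝ ≤ Λ * ‖ξ‖ ^ 2)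
    (ξ : EuclideanSpace ℝ (Fin 2)) : -⟪ξ, convect (fun _ => ξ) u x⟫_ℝ ≤ Λ * ‖ξ‖ ^ 2 := by
  set A : EuclideanSpace ℝ (Fin 2) →ₗ[ℝ] EuclideanSpace ℝ (Fin 2) :=
    (Torus.fderiv u x : EuclideanSpace ℝ (Fin 2) →ₗ[ℝ] EuclideanSpace ℝ (Fin 2)) with hA_def
  have hconv : ∀ η : EuclideanSpace ℝ (Fin 2), convect (fun _ => η) u x = A η := fun η => rfl
  set bF := EuclideanSpace.basisFun (Fin 2) ℝ with hbF
  set X : EuclideanSpace ℝ (Fin 2) := bF 0 with hX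
  set Y : EuclideanSpace ℝ (Fin 2) := bF 1 with hY
  -- the trace of `∇u(x)` is `div u(x) = 0`
  have htr : ⟪X, A X⟫_ℝ + ⟪Y, A Y⟫_ℝ = 0 := by
    have h1 := A.trace_eq_sum_inner bF
    rw [Fin.sum_univ_two] at h1
    rw [← h1, hA_def, ← divergence_eq_trace_fderiv hu x, hdiv x]
  -- orthonormality
  have hXX : ⟪X, X⟫_ℝ = 1 := by
    rw [real_inner_self_eq_norm_sq, bF.orthonormal.1 0, one_pow]
  have hYY : ⟪Y, Y⟫_ℝ = 1 := by
    rw [real_inner_self_eq_norm_sq, bF.orthonormal.1 1, one_pow]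
  have hXY : ⟪X, Y⟫_ℝ = 0 := bF.orthonormal.2 (by decide)
  have hYX : ⟪Y, X⟫_ℝ = 0 := bF.orthonormal.2 (by decide)
  -- coordinates of `ξ` and the rotated vector
  have hξ : ξ = ξ 0 • X + ξ 1 • Y := by
    have h := bF.sum_repr ξ
    rw [Fin.sum_univ_two] at h
    simp only [hbF, EuclideanSpace.basisFun_repr] at h
    exact h.symm
  set η : EuclideanSpace ℝ (Fin 2) := (-ξ 1) • X + ξ 0 • Y with hη_def
  have hnormξ : ‖ξ‖ ^ 2 = ξ 0 ^ 2 + ξ 1 ^ 2 := by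
    rw [← real_inner_self_eq_norm_sq]
    conv_lhs => rw [hξ]
    simp only [inner_add_left, inner_add_right, real_inner_smul_left, real_inner_smul_right, hXX,
      hYY, hXY, hYX]
    ring
  have hnormη : ‖η‖ ^ 2 = ξ 0 ^ 2 + ξ 1 ^ 2 := by
    rw [← real_inner_self_eq_norm_sq]
    simp only [hη_def, inner_add_left, inner_add_right, real_inner_smul_left,
      real_inner_smul_right, hXX, hYY, hXY, hYX]
    ring
  have hkey : ⟪ξ, A ξ⟫_ℝ + ⟪η, A η⟫_ℝ = 0 := by
    have h := inner_map_add_inner_map_rot A X Y (ξ 0) (ξ 1)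
    rw [← hξ] at h
    rw [h, htr, mul_zero]
  have hηle := hle η
  rw [hconv η, hnormη] at hηle
  rw [hconv ξ, hnormξ]
  linarith

variable {S : Set ℝ} {ν T : ℝ} {f ρ U V : ℝ → UnitAddTorus (Fin 2) → EuclideanSpace ℝ (Fin 2)}
  {qU qV : ℝ → UnitAddTorus (Fin 2) → ℝ} {Λ : ℝ → ℝ}

/-- **The planar statement with a one-sided strain bound** (the `NSEnergyStability` predicate of the
cell ad-ideate-p2's DriftFree line, crux K3loc): `U` solves the Navier–Stokes system on `T²` with
force `f + ρ`, `V` with force `f`, same viscosity `ν ≥ 0` and `U(0) = V(0)`, on a time set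
`S ⊇ [0, T]`; if the velocity gradient of `U` satisfies `⟪ξ, (ξ·∇)U(t, x)⟫ ≤ Λ(t)‖ξ‖²` on
`[0, T] × T²` with `Λ` continuous, then for `t ∈ [0, T]`
`‖V(t) - U(t)‖_{L²} ≤ ∫₀ᵗ exp(∫ₛᵗ Λ⁺) ‖ρ(s)‖_{L²} ds` (`div U = 0` turns the upper bound into the
lower bound `-⟪ξ, (ξ·∇)U⟫ ≤ Λ‖ξ‖² ≤ Λ⁺‖ξ‖²`, `….neg_inner_convect_le_of_inner_convect_le`, and the
basic energy estimate `….sqrt_integral_norm_sub_sq_le_of_forces` applies with the rate `Λ⁺`).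
[cite: MajdaBertozziCUP2002, §3.1.1 Lemma 3.1 and Prop. 3.1 (3.7)] -/
theorem IsClassicalNSSolutionOn.sqrt_vectorL2Sq_sub_le_duhamel_fin_two (hν : 0 ≤ ν)
    (hST : Icc 0 T ⊆ S) (hU : IsClassicalNSSolutionOn S ν (f + ρ) U qU)
    (hV : IsClassicalNSSolutionOn S ν f V qV) (h0 : U 0 = V 0)
    (hΛ : ∀ t ∈ Icc 0 T, ∀ (x : UnitAddTorus (Fin 2)) (ξ : EuclideanSpace ℝ (Fin 2)),
      ⟪ξ, convect (fun _ => ξ) (U t) x⟫_ℝ ≤ Λ t * ‖ξ‖ ^ 2)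
    (hΛc : ContinuousOn Λ (Icc 0 T)) {t : ℝ} (ht : t ∈ Icc 0 T) :
    Real.sqrt (FluidPDE.Torus.vectorL2Sq (V t - U t)) ≤
      ∫ s in (0 : ℝ)..t, Real.exp (∫ τ in s..t, max (Λ τ) 0) *
        Real.sqrt (FluidPDE.Torus.vectorL2Sq (ρ s)) := by
  have hΛ' : ∀ s ∈ Icc 0 T, ∀ (x : UnitAddTorus (Fin 2)) (ξ : EuclideanSpace ℝ (Fin 2)),
      -⟪ξ, convect (fun _ => ξ) (U s) x⟫_ℝ ≤ max (Λ s) 0 * ‖ξ‖ ^ 2 := by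
    intro s hs x ξ
    have hUs : IsContDiff 1 (U s) := (hU.smooth_velocity.isSmooth_slice (hST hs)).isContDiff (by simp)
    have h := neg_inner_convect_le_of_inner_convect_le hUs (hU.divFree s (hST hs)) (hΛ s hs x) ξ
    exact h.trans (mul_le_mul_of_nonneg_right (le_max_left _ _) (sq_nonneg _))
  have hΛc' : ContinuousOn (fun τ => max (Λ τ) 0) (Icc 0 T) :=
    (continuous_id.max continuous_const).comp_continuousOn hΛc
  have key := hV.sqrt_integral_norm_sub_sq_le_of_forces hST hU hν h0.symm hΛ' hΛc' ht
  have e1 : FluidPDE.Torus.vectorL2Sq (V t - U t) = ∫ x, ‖V t x - U t x‖ ^ 2 := by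
    simp only [FluidPDE.Torus.vectorL2Sq, Pi.sub_apply]
  have e2 : ∀ s, (∫ x, ‖f s x - (f + ρ) s x‖ ^ 2) = FluidPDE.Torus.vectorL2Sq (ρ s) := by
    intro s
    simp only [FluidPDE.Torus.vectorL2Sq, Pi.add_apply, sub_add_cancel_left, norm_neg]
  simp_rw [e2] at key
  rw [e1]
  exact key

end Plane

end Torus

end Literature.Analysis.FunctionSpaces

end
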